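import Summits.BirchSwinnertonDyer.BirchSwinnertonDyer.Theorems.ClassRecordThreeEulerHalvesAtThreeCartanCarayolCuspLift
import Summits.BirchSwinnertonDyer.BirchSwinnertonDyer.Theorems.ClassRecordThreeEulerHalvesAtThreeCartanCoverPrintClausesDivision
import Summits.BirchSwinnertonDyer.BirchSwinnertonDyer.Theorems.ClassRecordThreeEulerHalvesAtThreeCartanCarayolQuaternionNormalForm
import Literature.NumberTheory.Automorphic.JordanZassenhaus
import HarnessLib

/-!
# (SIGᶜ)(i) is a theorem: `Hom_par(Γ, ℤ)` has a finite `ℤ`-basis because `Γ = ι(O¹)` is finitely generated — a transfer from the Hodge lane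

Theorems only (no `def`, no named fact, no `_holds`, net debt `0`); part 2 of 2 (part 1: `…CartanCarayolQuaternionNormalForm.lean`). Route `ClassRecordThree`, crux `EulerHalvesAtThree` (item
`stmt-BirchSwinnertonDyer-19109`); node `CartanOnePlaceDegreeLawAtThree` (`stmt-…-24801`, line of record `Lines/lattice`), whose last
non-cite node (LIFT′) `CartanCarayol.CuspidalEigenCochainLiftPrimeToCartanPlaceAtThree` is assembled from four NAMED FACTS (ESᶜ), (SIGᶜ),
(JLᶜ), (COMMᶜ) by `cuspidalEigenCochainLift_of_facts` (`…CartanCarayolCuspLift.lean`). This file DISCHARGES CLAUSE (i) OF (SIGᶜ)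
`Literature.NumberTheory.Automorphic.parabolicCochain_free_and_modLift` — «the additive parabolic-null cochains `u : Γ → ℤ` of
`Γ = normOneUnits ι hO` have a finite `ℤ`-basis with unique coordinates» — for EVERY order `O` in EVERY quaternion algebra `B/ℚ` and
every injective `ι : B →ₐ[ℚ] M₂(ℝ)` (`parabolicCochain_free`), and re-assembles (LIFT′) from (ESᶜ) + clause (ii) of (SIGᶜ) + (JLᶜ) +
(COMMᶜ) (`cuspidalEigenCochainLift_of_facts_modLift`): the print input (SIGᶜ) shrinks to its mod-`n` lifting clause.

THE MECHANISM (lens `transfer`). Clause (i) is pure algebra once `Γ` is finitely generated — the tree's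
`CartanCover.PrintClauses.sigBasisClause_of_fg` (`…CartanCoverPrintClausesDivision.lean`, p748150: restriction to a finite generating set
embeds the `ℤ`-module of additive parabolic-null cochains into `ℤ^S`; finitely generated torsion-free ⇒ `Module.finBasis`), which asks for
`[Group.FG (normOneUnits ι hO)]`; its sibling `CartanLevelCurveData.fg_normOneUnits_eraseOrder` (`ShimuraCurveCartanLevelFinitelyGenerated.lean`,
p748290) supplies that instance for the Cartan cover groups. THIS FILE supplies it for EVERY order: FINITE GENERATION OF `Γ = ι(O¹)`
(`fg_normOneUnits`) is transported from the Hodge lane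
`Literature/Geometry/Kaehler/ComplexTorusQuaternion*` (lane `lit-hodgefound`: the family `Γ_{a,b} = ρ(𝔬¹) ≤ SL₂(ℝ)` of Lang IX / Bergeron §2.2,
with `fg_unitGroup` / `fg_congruenceUnitGroup` = Bergeron Lemma 2.7 (cocompact or arithmetic) + Reidemeister–Schreier): (1)–(2) normal form
`B ≅ (a, b)_ℚ`, `a, b ∈ ℤ`, `a ≠ 0 < b` and Skolem–Noether `ι = h ρ(·) h⁻¹` — part 1, `…CartanCarayolQuaternionNormalForm.lean`
(`exists_int_pos_nonempty_algEquiv_quaternionAlgebra`, `exists_units_forall_eq_conj'`; indefiniteness of `B` is PROVED there from `ι`,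
not assumed); (3) the orders `O` and `𝔬 = ℤ⟨1, i, j, ij⟩` are commensurable lattices
(`exists_smul_mem_of_fg` of `JordanZassenhaus.lean`, both ways), so `K := h·Γ_{a,b}(N)·h⁻¹ ≤ Γ` for `N𝔬 ⊆ O`, `K` is finitely generated,
and `K` contains every `g = ι(x) ∈ Γ` with `x ≡ 1 (mod N·M₀·O)` (`M₀O ⊆ 𝔬`); (4) such principal-level elements have finite index in `Γ`
(`finiteIndex_subgroupOf_normOneUnits_of_level`: the residue of a lift `x_g ∈ O` in the finite group `O/(M·O)` —
`relIndex_ne_zero_of_smul_mem` — determines the coset `gK`); (5) a finite-index overgroup of a finitely generated group is finitely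
generated (`subgroupFG_of_le_of_finiteIndex`, Schreier). Steps (3)–(4) are Vignéras IV Prop. 1.4 («Les groupes O¹, pour O ∈ Ω, sont
commensurables deux à deux») for a general — not necessarily maximal or Eichler — order, typed over `normOneUnits`.

WHAT THIS DOES NOT DO. Clause (ii) of (SIGᶜ) (torsion-null, parabolic-null mod-`n` characters lift: `Γ^{ab}/⟨finite order, parabolic⟩`
is torsion-free — the Poincaré-polygon presentation) is NOT proved and stays a hypothesis (`hLIFT`, stated verbatim as the second
conjunct of the named fact, no new definition); (ESᶜ), (JLᶜ), (COMMᶜ) are untouched. No statement of the summit, of `ClassRecordThree`,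
or of any crux is proved here; BSD is proved for no curve.

## References
* [VignerasLNM800] M.-F. Vignéras, *Arithmétique des algèbres de quaternions*, LNM 800 (1980), Ch. I §1 (standard basis, p. 1–3);
  Ch. IV §1 Thm. 1.1, Prop. 1.4, Cor. 1.5 (p. 104–105: `O¹` discrete of finite covolume; unit groups of orders pairwise commensurable);
  Ch. IV §2 (fundamental polygon: «Le groupe Γ̄ est de type fini»).
* [Bergeron2016] N. Bergeron, *The Spectrum of Hyperbolic Surfaces* (2016), §2.2 Thm. 2.3, §2.2.1 Lemma 2.5, Lemma 2.7 (pp. 36–41).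
* [Voight2021] J. Voight, *Quaternion Algebras*, GTM 288, §7.7 Main Thm. 7.7.1, Cor. 7.7.4 (Skolem–Noether).
* [ShimuraIATAF1971] G. Shimura, *Introduction to the arithmetic theory of automorphic functions* (1971), Thm. 8.4, §8.2 (8.2.6) p. 232, §9.2 p. 246.
* [Iwaniec2002] H. Iwaniec, *Spectral methods of automorphic forms*, 2nd ed. (2002), Ch. 2 Prop. 2.3, Prop. 2.6.
-/

set_option linter.dupNamespace false

noncomputable section

open scoped Classical MatrixGroups Quaternion Pointwise

namespace Summit.BirchSwinnertonDyer.BirchSwinnertonDyer.Theorems.CartanCarayol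

open Literature.NumberTheory.Automorphic
open Literature.Geometry.Kaehler.ComplexTorus

/-! ## §2 `Γ = ι(O¹)` is finitely generated (transfer from the Hodge lane's `Γ_{a,b}`) -/

section Quaternion

open Literature.Geometry.Kaehler.ComplexTorus.QuaternionType

/-! ### §2a Finite index of principal-level subgroups of `ι(O¹)` -/

/-- Matrix inverses inside `ι(O)`: if `x y ∈ O` with `xy = 1` and `ι(x) = g`, `det g = 1`, then `g ∈ ι(O¹)`. [folklore] -/
theorem mem_normOneUnits_of_mul_eq_one {B : Type*} [Ring B] [Algebra ℚ B] (ι : B →ₐ[ℚ] Matrix (Fin 2) (Fin 2) ℝ)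
    {O : Submodule ℤ B} (hO : Brandt.IsOrder B O) {x y : B} (hx : x ∈ O) (hy : y ∈ O) (hxy : x * y = 1)
    {g : GL (Fin 2) ℝ} (hg : ι x = (g : Matrix (Fin 2) (Fin 2) ℝ)) (hdet : Matrix.GeneralLinearGroup.det g = 1) :
    g ∈ normOneUnits ι hO := by
  refine ⟨⟨x, hx, hg⟩, ⟨y, hy, ?_⟩, hdet⟩
  have h1 : (g : Matrix (Fin 2) (Fin 2) ℝ) * ι y = 1 := by rw [← hg, ← map_mul, hxy, map_one]
  rw [Matrix.coe_units_inv, Matrix.inv_eq_right_inv h1]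

/-- **Principal-level elements have finite index in `Γ = ι(O¹)`.** For an injective `ι`, an order `O`, an integer
`M ≠ 0` and any subgroup `K ≤ GL₂(ℝ)` containing every `g = ι(x) ∈ Γ` with `x ≡ 1 (mod M·O)`, the subgroup `K ∩ Γ`
has finite index in `Γ`: the residue of `x_g` in the finite group `O / M·O` (finite by the tree's
`relIndex_ne_zero_of_smul_mem`) determines the coset `gK` (`x_g⁻¹ x_{g′} ≡ 1`). This is the «principal congruence
subgroups have finite index» step of Vignéras IV.1 / Bergeron Lemma 2.5 for a general order. [cite: VignerasLNM800, Ch. IV §1 Prop. 1.4 p. 105] [cite: Bergeron2016, §2.2.1 Lemma 2.5 p. 39] -/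
theorem finiteIndex_subgroupOf_normOneUnits_of_level {B : Type*} [Ring B] [Algebra ℚ B]
    (ι : B →ₐ[ℚ] Matrix (Fin 2) (Fin 2) ℝ) {O : Submodule ℤ B} (hO : Brandt.IsOrder B O)
    (hι : Function.Injective ι) {M : ℤ} (hM : M ≠ 0) (K : Subgroup (GL (Fin 2) ℝ))
    (hK : ∀ g ∈ normOneUnits ι hO,
      (∃ x ∈ O, ι x = (g : Matrix (Fin 2) (Fin 2) ℝ) ∧ ∃ y ∈ O, x - 1 = M • y) → g ∈ K) :
    (K.subgroupOf (normOneUnits ι hO)).FiniteIndex := by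
  classical
  haveI : IsAddTorsionFree B := isAddTorsionFree_of_charZero_module ℚ B
  set A := normOneUnits ι hO with hA
  -- chosen lifts `x_g, y_g ∈ O` of `g, g⁻¹`
  have hxex : ∀ g : A, ∃ x ∈ O, ι x = ((g : GL (Fin 2) ℝ) : Matrix (Fin 2) (Fin 2) ℝ) := fun g => g.2.1
  choose xr hxrO hxr using hxex
  have hyex : ∀ g : A, ∃ y ∈ O, ι y = (((g : GL (Fin 2) ℝ)⁻¹ : GL (Fin 2) ℝ) : Matrix (Fin 2) (Fin 2) ℝ) :=
    fun g => g.2.2.1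
  choose yr hyrO hyr using hyex
  have hyx : ∀ g : A, yr g * xr g = 1 := fun g => hι (by rw [map_mul, hyr, hxr, map_one, Units.inv_mul])
  -- the finite target `O / M•O`
  set P : Submodule ℤ B := M • O with hP
  have hPO : ∀ x ∈ O, M • x ∈ P := fun x hx => Submodule.smul_mem_pointwise_smul x M O hx
  have hidx : (P.toAddSubgroup.addSubgroupOf O.toAddSubgroup).index ≠ 0 := by
    have := relIndex_ne_zero_of_smul_mem O hO.isFullLattice.1 hM P hPO
    rwa [AddSubgroup.relIndex] at this
  haveI hfi : (P.toAddSubgroup.addSubgroupOf O.toAddSubgroup).FiniteIndex := ⟨hidx⟩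
  haveI : Finite (O.toAddSubgroup ⧸ P.toAddSubgroup.addSubgroupOf O.toAddSubgroup) :=
    AddSubgroup.finite_quotient_of_finiteIndex
  let φ : A → O.toAddSubgroup ⧸ P.toAddSubgroup.addSubgroupOf O.toAddSubgroup :=
    fun g => ((⟨xr g, hxrO g⟩ : O.toAddSubgroup) : O.toAddSubgroup ⧸ P.toAddSubgroup.addSubgroupOf O.toAddSubgroup)
  -- equal residues ⇒ same coset of `K ∩ Γ`
  have key : ∀ g g' : A, φ g = φ g' → g⁻¹ * g' ∈ K.subgroupOf A := by
    intro g g' hgg'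
    have hmem : -xr g + xr g' ∈ P := by
      have h := QuotientAddGroup.eq.mp hgg'
      rw [AddSubgroup.mem_addSubgroupOf] at h
      simpa using h
    obtain ⟨w, hwO, hw⟩ := (Submodule.mem_smul_pointwise_iff_exists _ _ _).mp hmem
    rw [Subgroup.mem_subgroupOf]
    refine hK _ (g⁻¹ * g').2 ⟨yr g * xr g', hO.mul_mem _ (hyrO g) _ (hxrO g'), ?_, yr g * w,
      hO.mul_mem _ (hyrO g) _ hwO, ?_⟩
    · rw [map_mul, hyr, hxr, Subgroup.coe_mul, Subgroup.coe_inv, Units.val_mul]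
    · calc yr g * xr g' - 1 = yr g * (-xr g + xr g') := by rw [mul_add, mul_neg, hyx, neg_add_eq_sub]
        _ = M • (yr g * w) := by rw [← hw, mul_smul_comm]
  -- a section of `φ` over its (finite) range surjects onto the coset space
  have hne : ∀ t : Set.range φ, ∃ g : A, φ g = t := fun t => t.2
  choose sec hsec using hne
  have hsurj : Function.Surjective (fun t : Set.range φ => (QuotientGroup.mk (sec t) : A ⧸ K.subgroupOf A)) := by
    intro q
    induction q using QuotientGroup.induction_on with
    | H g =>
      refine ⟨⟨φ g, g, rfl⟩, ?_⟩
      exact QuotientGroup.eq.mpr (key _ _ (by rw [hsec]))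
  haveI : Finite (A ⧸ K.subgroupOf A) := Finite.of_surjective _ hsurj
  exact Subgroup.finiteIndex_of_finite_quotient

/-! ### §2b Group-theoretic plumbing (re-proofs of private lemmas of `…UnitGroupFinitelyGeneratedSplit`) -/

/-- The image of a finitely generated subgroup under a homomorphism is finitely generated. [folklore] -/
private theorem subgroupFG_map {G G' : Type*} [Group G] [Group G'] (f : G →* G') {H : Subgroup G} (hH : H.FG) :
    (H.map f).FG := by
  haveI : Group.FG H := (Group.fg_iff_subgroup_fg H).mpr hH
  have h : Group.FG (f.comp H.subtype).range := Group.fg_range _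
  rw [MonoidHom.range_comp, Subgroup.range_subtype] at h
  exact (Group.fg_iff_subgroup_fg _).mp h

/-- A conjugate of a finitely generated subgroup is finitely generated. [folklore] -/
private theorem subgroupFG_conjAct_smul {G : Type*} [Group G] (g : G) {H : Subgroup G} (hH : H.FG) :
    (ConjAct.toConjAct g • H).FG := by
  rw [Subgroup.pointwise_smul_def]
  exact subgroupFG_map _ hH

/-! ### §2c The transfer: `ι(O¹)` is finitely generated -/

/-- **`Γ = ι(O¹)` is finitely generated** for every order `O` in a quaternion algebra `B` over `ℚ` and every
injective `ι : B →ₐ[ℚ] M₂(ℝ)`. TRANSFER from the Hodge lane (`Literature/Geometry/Kaehler/ComplexTorusQuaternion*`,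
lane `lit-hodgefound`): normalise `B ≅ (a, b)_ℚ` (`a, b ∈ ℤ`, `a ≠ 0 < b`,
`exists_int_pos_nonempty_algEquiv_quaternionAlgebra`); by Skolem–Noether `ι = h ρ h⁻¹` on `B ≅ (a, b)_ℚ`; the two
orders `O` and `𝔬 = ℤ⟨1, i, j, ij⟩` are commensurable lattices (`exists_smul_mem_of_fg`: `N𝔬 ⊆ O ∧ M₀O ⊆ 𝔬` after
transport), so `K := h·Γ_{a,b}(N)·h⁻¹ ≤ Γ` — `K` finitely generated by the Hodge lane's `fg_congruenceUnitGroup`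
(Bergeron Lemma 2.7 + Reidemeister–Schreier) — and `K` contains every element of `Γ` of level `N·M₀`, which have
finite index in `Γ` (`finiteIndex_subgroupOf_normOneUnits_of_level`); a finite-index overgroup of a finitely
generated group is finitely generated (`subgroupFG_of_le_of_finiteIndex`). [cite: VignerasLNM800, Ch. IV §1 Thm. 1.1 and Prop. 1.4 p. 104–105 (O¹ ↪ SL₂(ℝ) discrete of finite covolume; «Les groupes O¹, pour O ∈ Ω, sont commensurables deux à deux»); Ch. IV §2 («Le groupe Γ̄ est de type fini»)] [cite: Bergeron2016, §2.2 Thm. 2.3, §2.2.1 Lemma 2.5, Lemma 2.7 pp. 36–41] -/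
theorem fg_normOneUnits (B : Type*) [Ring B] [Algebra ℚ B] [IsQuaternionAlgebra ℚ B] (O : Submodule ℤ B)
    (hO : Brandt.IsOrder B O) (ι : B →ₐ[ℚ] Matrix (Fin 2) (Fin 2) ℝ) (hι : Function.Injective ι) :
    (normOneUnits ι hO).FG := by
  classical
  obtain ⟨a, b, ha, hb, ⟨f⟩⟩ := exists_int_pos_nonempty_algEquiv_quaternionAlgebra B ι
  -- Skolem–Noether: `ι = h ρ(f ·) h⁻¹`
  obtain ⟨h, hh⟩ := exists_units_forall_eq_conj' ha hb (ι.comp (f.symm : ℍ[ℚ,(a : ℚ),(b : ℚ)] →ₐ[ℚ] B))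
  have hhs : ∀ y : ℍ[ℚ,(a : ℚ),(b : ℚ)], ι (f.symm y) =
      (h : Matrix (Fin 2) (Fin 2) ℝ) * rho a b hb.le (castQ a b y) * ((h⁻¹ : GL (Fin 2) ℝ) : Matrix (Fin 2) (Fin 2) ℝ) :=
    fun y => by simpa only [AlgHom.comp_apply, AlgEquiv.coe_toAlgHom] using hh y
  have hconj : ∀ x : B, ι x =
      (h : Matrix (Fin 2) (Fin 2) ℝ) * rho a b hb.le (castQ a b (f x)) * ((h⁻¹ : GL (Fin 2) ℝ) : Matrix (Fin 2) (Fin 2) ℝ) :=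
    fun x => by simpa only [AlgEquiv.symm_apply_apply] using hhs (f x)
  -- `ℤ`-linear transport along `f`
  let fZ : B →ₗ[ℤ] ℍ[ℚ,(a : ℚ),(b : ℚ)] := (f : B →+* ℍ[ℚ,(a : ℚ),(b : ℚ)]).toAddMonoidHom.toIntLinearMap
  let gZ : ℍ[ℚ,(a : ℚ),(b : ℚ)] →ₗ[ℤ] B := (f.symm : ℍ[ℚ,(a : ℚ),(b : ℚ)] →+* B).toAddMonoidHom.toIntLinearMap
  -- (1) `N·𝔬 ⊆ f(O)`
  obtain ⟨n, hn0, hn⟩ := exists_smul_mem_of_fg hO.isFullLattice ((isOrder_orderSubmodule a b).isFullLattice.1.map gZ)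
  set N : ℕ := n.natAbs with hNdef
  have hN0 : N ≠ 0 := Int.natAbs_ne_zero.mpr hn0
  have hNmem : ∀ η ∈ order a b, N • f.symm η ∈ O := by
    intro η hη
    have hx : f.symm η ∈ (orderSubmodule a b).map gZ := Submodule.mem_map_of_mem (f := gZ) hη
    have h1 := hn _ hx
    rw [← natCast_zsmul]
    rcases Int.natAbs_eq n with h' | h'
    · rwa [hNdef, ← h']
    · have h2 : (N : ℤ) = -n := by rw [hNdef]; omega
      rw [h2, neg_smul]
      exact O.neg_mem h1
  -- (2) `M₀·f(O) ⊆ 𝔬`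
  obtain ⟨M₀, hM₀0, hM₀⟩ := exists_smul_mem_of_fg (isOrder_orderSubmodule a b).isFullLattice (hO.isFullLattice.1.map fZ)
  have hM₀mem : ∀ x ∈ O, M₀ • f x ∈ order a b := fun x hx => hM₀ _ (Submodule.mem_map_of_mem (f := fZ) hx)
  -- the finitely generated subgroup `K = h Γ_{a,b}(N) h⁻¹`
  set K : Subgroup (GL (Fin 2) ℝ) :=
    ConjAct.toConjAct h • (congruenceUnitGroup a b hb.le N).map Matrix.SpecialLinearGroup.toGL with hKdef
  have hKfg : K.FG := subgroupFG_conjAct_smul h (subgroupFG_map _ (fg_congruenceUnitGroup ha hb hN0))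
  -- `K ≤ Γ`
  have hKle : K ≤ normOneUnits ι hO := by
    intro g hg
    rw [hKdef, Subgroup.mem_pointwise_smul_iff_inv_smul_mem, Subgroup.mem_map] at hg
    obtain ⟨z, hz, hzg⟩ := hg
    rw [ConjAct.smul_def, map_inv, ConjAct.ofConjAct_toConjAct, inv_inv] at hzg
    have hg' : g = h * Matrix.SpecialLinearGroup.toGL z * h⁻¹ := by rw [hzg]; group
    obtain ⟨ε, hεO, hε1, ⟨η, hη, hεη⟩, hzε⟩ := hz
    have hxO : f.symm ε ∈ O := by
      rw [hεη, map_add, map_one, map_nsmul]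
      exact O.add_mem hO.one_mem (hNmem η hη)
    have hyO : f.symm (star ε) ∈ O := by
      rw [hεη, star_add, star_one, star_nsmul, map_add, map_one, map_nsmul]
      exact O.add_mem hO.one_mem (hNmem _ (star_mem_order hη))
    refine mem_normOneUnits_of_mul_eq_one ι hO hxO hyO ?_ ?_ ?_
    · rw [← map_mul, hε1, map_one]
    · rw [hhs, ← hzε, hg', Units.val_mul, Units.val_mul, Matrix.SpecialLinearGroup.coe_GL_coe_matrix]
    · rw [hg', map_mul, map_mul, map_inv, mul_inv_cancel_comm]
      ext
      rw [Matrix.GeneralLinearGroup.val_det_apply, Matrix.SpecialLinearGroup.coe_GL_coe_matrix, z.prop, Units.val_one]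
  -- every element of `Γ` of level `N·M₀` lies in `K`
  have hlevel : ∀ g ∈ normOneUnits ι hO,
      (∃ x ∈ O, ι x = (g : Matrix (Fin 2) (Fin 2) ℝ) ∧ ∃ y ∈ O, x - 1 = ((N : ℤ) * M₀) • y) → g ∈ K := by
    rintro g hg ⟨x, hxO, hxg, y, hyO, hxy⟩
    have hdetg : ((g : GL (Fin 2) ℝ) : Matrix (Fin 2) (Fin 2) ℝ).det = 1 := by
      have := congrArg Units.val hg.2.2
      rwa [Matrix.GeneralLinearGroup.val_det_apply, Units.val_one] at this
    have hη : M₀ • f y ∈ order a b := hM₀mem y hyO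
    have hεη : f x = 1 + N • (M₀ • f y) := by
      have hx1 : x = 1 + ((N : ℤ) * M₀) • y := by rw [← hxy]; abel
      rw [hx1, map_add, map_one, map_zsmul, mul_smul, natCast_zsmul]
    have hεO : f x ∈ order a b := by
      rw [hεη]; exact (order a b).add_mem (order a b).one_mem ((order a b).nsmul_mem hη N)
    have hρ : rho a b hb.le (castQ a b (f x)) =
        ((h⁻¹ : GL (Fin 2) ℝ) : Matrix (Fin 2) (Fin 2) ℝ) * (g : Matrix (Fin 2) (Fin 2) ℝ) * (h : Matrix (Fin 2) (Fin 2) ℝ) := by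
      rw [← hxg, hconj x]
      simp only [← mul_assoc, Units.inv_mul, one_mul, Units.inv_mul_cancel_right]
    have hdet : (rho a b hb.le (castQ a b (f x))).det = 1 := by
      rw [hρ, Matrix.det_units_conj']
      exact hdetg
    have hε1 : f x * star (f x) = 1 := mul_star_self_eq_one_of_det_eq_one hb.le hdet
    let z : SL(2, ℝ) := ⟨rho a b hb.le (castQ a b (f x)), hdet⟩
    have hzval : ((Matrix.SpecialLinearGroup.toGL z : GL (Fin 2) ℝ) : Matrix (Fin 2) (Fin 2) ℝ) =
        rho a b hb.le (castQ a b (f x)) := rfl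
    have hz : z ∈ congruenceUnitGroup a b hb.le N := ⟨f x, hεO, hε1, ⟨M₀ • f y, hη, hεη⟩, rfl⟩
    have hgz : g = ConjAct.toConjAct h • Matrix.SpecialLinearGroup.toGL z := by
      rw [ConjAct.toConjAct_smul]
      apply Units.ext
      rw [Units.val_mul, Units.val_mul, hzval, ← hxg, hconj x]
    rw [hgz, hKdef]
    exact Subgroup.smul_mem_pointwise_smul _ _ _ (Subgroup.mem_map_of_mem _ hz)
  haveI := finiteIndex_subgroupOf_normOneUnits_of_level ι hO hι
    (mul_ne_zero (Int.natCast_ne_zero.mpr hN0) hM₀0) K hlevel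
  exact subgroupFG_of_le_of_finiteIndex hKle hKfg

end Quaternion

/-! ## §3 Clause (i) of (SIGᶜ) is a theorem; the cusp-lift glue needs only clause (ii) -/

section Glue

open Literature.NumberTheory.Automorphic

/-- **Clause (i) of `parabolicCochain_free_and_modLift` (SIGᶜ) holds unconditionally**: for every order `O` in a
quaternion algebra `B/ℚ` and every injective `ι : B → M₂(ℝ)`, `Hom_par(Γ, ℤ)` (`Γ = ι(O¹)`) has a finite `ℤ`-basis
with unique coordinates — `Γ` is finitely generated (`fg_normOneUnits`) and the tree's `CartanCover.PrintClauses.sigBasisClause_of_fg`.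
[cite: ShimuraIATAF1971, §8.2 (8.2.6) p. 232 and §9.2 p. 246] [cite: VignerasLNM800, Ch. IV §1 Thm. 1.1, Prop. 1.4; Ch. IV §2 («Le groupe Γ̄ est de type fini»)] -/
theorem parabolicCochain_free :
    ∀ (B : Type) [Ring B] [Algebra ℚ B] [IsQuaternionAlgebra ℚ B] (O : Submodule ℤ B) (hO : Brandt.IsOrder B O)
      (ι : B →ₐ[ℚ] Matrix (Fin 2) (Fin 2) ℝ), Function.Injective ι →
      ∃ (r : ℕ) (e : Fin r → (normOneUnits ι hO → ℤ)),
        (∀ i, (∀ γ δ : normOneUnits ι hO, e i (γ * δ) = e i γ + e i δ) ∧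
          (∀ γ : normOneUnits ι hO, (γ : GL (Fin 2) ℝ).IsParabolic → e i γ = 0)) ∧
        ∀ u : normOneUnits ι hO → ℤ,
          (∀ γ δ : normOneUnits ι hO, u (γ * δ) = u γ + u δ) →
          (∀ γ : normOneUnits ι hO, (γ : GL (Fin 2) ℝ).IsParabolic → u γ = 0) →
          ∃! c : Fin r → ℤ, u = fun γ => ∑ i, c i * e i γ := by
  intro B _ _ _ O hO ι hι
  haveI : Group.FG (normOneUnits ι hO) := (Group.fg_iff_subgroup_fg _).mpr (fg_normOneUnits B O hO ι hι)
  exact CartanCover.PrintClauses.sigBasisClause_of_fg ι hO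

/-- **(SIGᶜ) from its clause (ii) alone.** The named fact `parabolicCochain_free_and_modLift` follows from its second
clause (the mod-`n` lift of finite-order-null parabolic-null additive characters); clause (i) is `parabolicCochain_free`.
[cite: ShimuraIATAF1971, §8.2 (8.2.6) p. 232 and §9.2 p. 246] [cite: Iwaniec2002, Ch. 2 Prop. 2.3 and Prop. 2.6] -/
theorem parabolicCochain_free_and_modLift_of_modLift
    (hLIFT : ∀ (B : Type) [Ring B] [Algebra ℚ B] [IsQuaternionAlgebra ℚ B] (O : Submodule ℤ B)
      (hO : Brandt.IsOrder B O) (ι : B →ₐ[ℚ] Matrix (Fin 2) (Fin 2) ℝ), Function.Injective ι →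
      ∀ (n : ℕ), n ≠ 0 → ∀ ψ : normOneUnits ι hO → ZMod n,
        (∀ γ δ : normOneUnits ι hO, ψ (γ * δ) = ψ γ + ψ δ) →
        (∀ γ : normOneUnits ι hO, IsOfFinOrder γ → ψ γ = 0) →
        (∀ γ : normOneUnits ι hO, (γ : GL (Fin 2) ℝ).IsParabolic → ψ γ = 0) →
        ∃ u : normOneUnits ι hO → ℤ,
          (∀ γ δ : normOneUnits ι hO, u (γ * δ) = u γ + u δ) ∧
          (∀ γ : normOneUnits ι hO, (γ : GL (Fin 2) ℝ).IsParabolic → u γ = 0) ∧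
          ∀ γ : normOneUnits ι hO, (u γ : ZMod n) = ψ γ) :
    parabolicCochain_free_and_modLift :=
  fun B _ _ _ O hO ι hι => ⟨parabolicCochain_free B O hO ι hι, hLIFT B O hO ι hι⟩

/-- **The cusp lift (LIFT′) from (ESᶜ) + clause (ii) of (SIGᶜ) + (JLᶜ) + (COMMᶜ)** — the print input (SIGᶜ) of
`cuspidalEigenCochainLift_of_facts` (p746593) shrinks to its mod-`n` lifting clause; the lattice clause (i) is now the
theorem `parabolicCochain_free`. No summit statement is proved here. [cite: ShimuraIATAF1971, Thm. 8.4, §8.2 (8.2.6) p. 232] [cite: DeligneSerre1974, Lemme 6.11] -/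
theorem cuspidalEigenCochainLift_of_facts_modLift (hES : eichlerShimura_weightTwo_rePeriod)
    (hLIFT : ∀ (B : Type) [Ring B] [Algebra ℚ B] [IsQuaternionAlgebra ℚ B] (O : Submodule ℤ B)
      (hO : Brandt.IsOrder B O) (ι : B →ₐ[ℚ] Matrix (Fin 2) (Fin 2) ℝ), Function.Injective ι →
      ∀ (n : ℕ), n ≠ 0 → ∀ ψ : normOneUnits ι hO → ZMod n,
        (∀ γ δ : normOneUnits ι hO, ψ (γ * δ) = ψ γ + ψ δ) →
        (∀ γ : normOneUnits ι hO, IsOfFinOrder γ → ψ γ = 0) →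
        (∀ γ : normOneUnits ι hO, (γ : GL (Fin 2) ℝ).IsParabolic → ψ γ = 0) →
        ∃ u : normOneUnits ι hO → ℤ,
          (∀ γ δ : normOneUnits ι hO, u (γ * δ) = u γ + u δ) ∧
          (∀ γ : normOneUnits ι hO, (γ : GL (Fin 2) ℝ).IsParabolic → u γ = 0) ∧
          ∀ γ : normOneUnits ι hO, (u γ : ZMod n) = ψ γ)
    (hJL : jacquetLanglands_cartanCover_newform) (hCOMM : unitsHeckeFun_comm_cartanCover) :
    CuspidalEigenCochainLiftPrimeToCartanPlaceAtThree :=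
  cuspidalEigenCochainLift_of_facts hES (parabolicCochain_free_and_modLift_of_modLift hLIFT) hJL hCOMM

end Glue

end Summit.BirchSwinnertonDyer.BirchSwinnertonDyer.Theorems.CartanCarayol
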